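import Summits.CriticalPhenomena.CardyFormulaZ2.Theorems.CardyUSTContinuationKirchhoffExtremalLengthG02Dual3
import Summits.CriticalPhenomena.CardyFormulaZ2.Theorems.CardyUSTContinuationKirchhoffExtremalLengthG02Dual4
import Literature.Probability.LatticeModels.SquareTilingCrosscut
import Literature.Probability.LatticeModels.SquareTilingUniformization

/-!
# Crosscut bookkeeping: the flux identity for a loop through two exits, inner faces in the bulk,
# exit decompositions and face walks along an arc (G02 discretisation)

Support file for `KirchhoffExtremalLength` (route CardyUSTContinuation of `CardyFormulaZ2`, item
stmt-CriticalPhenomena-11234), towards the upper half of `G02ModulusConvergence` (`…Defs.lean`).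
Transposition of the discretisation-dependent lemmas of §W1–§W6 of the tree's
`SquareTilingCrosscut.lean` to `Ω_δ = discreteDomainGraph Ω δ`:

* `stepFlux_right_ecur`, `stepFlux_up_ecur`, `exists_faceGraph_walk`, `walkFlux_eq_facePot_sub`,
  `stepFlux_eq_zero_of_not_mem_meshDomain`;
* `exists_forall_isInnerFace`, `exists_forall_isInnerFace_of_near` (squares of compact subsets of
  a Jordan domain are inner faces for small meshes — `MeshDomainJordan.lean`),
  `reachable_of_mem_support_inner`;
* the **flux identity** `faceExitVal_sub_faceExitVal_eq` for a closed walk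
  `exit⁻¹ ++ (component walk) ++ exit ++ (flux-free closing)`;
* `exists_exit_decomp`, `exists_faceWalk_along_arc`.
-/

noncomputable section

namespace Summit.CriticalPhenomena.CardyFormulaZ2.Theorems

namespace KirchhoffSlope

open Set Metric Filter Topology SimpleGraph
open Literature.Probability Literature.Probability.LatticeModels Literature.Probability.Percolation
open Literature.Probability.LatticeModels.SquareTiling (stepFlux walkFlux walkFlux_cons walkFlux_append
  stepFlux_antisymm closedSq floorSq mem_closedSq_floorSq meshPoint_mem_closedSq side_subset_closedSq
  dist_le_of_mem_closedSq exists_dualWalk_of_path stepFlux_right_eq stepFlux_up_eq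
  walkFlux_eq_mul_sum_div divAt sepLo_sepHi_right sepLo_sepHi_up)
open Literature.Probability.RandomPlanarGeometry

variable {Ω : Set ℂ} {δ : ℝ}

open WeakBeurling

/-- The CR-increment of `h'` across the right side of the square `x`. [folklore] -/
theorem stepFlux_right_ecur (h : Site 2 → ℝ) (x : Site 2) :
    stepFlux (ecurH Ω δ h) (ecurV Ω δ h) x (x + Pi.single 0 1) = -ecur Ω δ h (x + Pi.single 0 1) (x + Pi.single 0 1 + Pi.single 1 1) := by
  rw [stepFlux_right_eq, ecurV]
  congr 2 <;> rw [one_eq_single_add_single] <;> abel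

/-- Across the top side. [folklore] -/
theorem stepFlux_up_ecur (h : Site 2 → ℝ) (x : Site 2) :
    stepFlux (ecurH Ω δ h) (ecurV Ω δ h) x (x + Pi.single 1 1) = ecur Ω δ h (x + Pi.single 1 1) (x + Pi.single 1 1 + Pi.single 0 1) := by
  rw [stepFlux_up_eq, ecurH]
  congr 1 <;> rw [one_eq_single_add_single] <;> abel


/-- A `zdGraph` walk all of whose vertices are inner squares lifts to the dual graph. [folklore] -/
theorem exists_faceGraph_walk :
    ∀ {x y : Site 2} (w : (zdGraph 2).Walk x y), (∀ z ∈ w.support, IsInnerFace Ω δ z) →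
      ∃ W : (faceGraph Ω δ).Walk x y, W.map (Hom.ofLE faceGraph_le_zdGraph') = w := by
  intro x y w
  induction w with
  | nil => intro _; exact ⟨Walk.nil, rfl⟩
  | cons h w ih =>
    rename_i a b c
    intro hs
    have ha : IsInnerFace Ω δ a := hs a (by simp)
    have hb : IsInnerFace Ω δ b := hs b (by simp)
    obtain ⟨W, hW⟩ := ih fun z hz => hs z (by simp [hz])
    refine ⟨Walk.cons (faceGraph_adj_iff.2 ⟨h, ha, hb⟩) W, ?_⟩
    simp [hW]

open Classical in
/-- **Flux along a walk of the component is the increment of the conjugate.** [folklore] -/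
theorem walkFlux_eq_facePot_sub (R : ConformalRectangle) (hδ : 0 < δ) {h : Site 2 → ℝ} {T B : Set (Site 2)}
    (hT : T ⊆ meshBoundary R.carrier δ) (hB : B ⊆ meshBoundary R.carrier δ)
    (hharm : ∀ x, x ∉ T → x ∉ B →
      ∑ y ∈ ((zdGraph 2).neighborFinset x).filter (fun y => (discreteDomainGraph R.carrier δ).Adj x y), (h y - h x) = 0)
    {p₀ x y : Site 2} (hp₀ : IsInnerFace R.carrier δ p₀) (hx : (faceGraph R.carrier δ).Reachable p₀ x)
    (w : (zdGraph 2).Walk x y) (hw : ∀ z ∈ w.support, IsInnerFace R.carrier δ z) :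
    walkFlux (ecurH R.carrier δ h) (ecurV R.carrier δ h) w =
      facePot R.carrier δ h p₀ y - facePot R.carrier δ h p₀ x := by
  obtain ⟨W, hW⟩ := exists_faceGraph_walk w hw
  obtain ⟨W₀⟩ := hx
  have e : walkFlux (ecurH R.carrier δ h) (ecurV R.carrier δ h) (W.map (Hom.ofLE faceGraph_le_zdGraph')) =
      walkFlux (ecurH R.carrier δ h) (ecurV R.carrier δ h) w := congrArg _ hW
  rw [facePot_eq_walkFlux R hδ hT hB hharm hp₀ (W₀.append W), facePot_eq_walkFlux R hδ hT hB hharm hp₀ W₀,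
    Walk.map_append, walkFlux_append, e]
  ring



/-- A dart whose crossed side has an endpoint outside the vertex set `domain` carries no flux.
[folklore] -/
theorem stepFlux_eq_zero_of_not_mem_meshDomain {Ω : Set ℂ} (h : Site 2 → ℝ) {x y : Site 2} (hxy : (zdGraph 2).Adj x y)
    (hc : sepLo x y ∉ meshDomain Ω δ ∨ sepHi x y ∉ meshDomain Ω δ) :
    stepFlux (ecurH Ω δ h) (ecurV Ω δ h) x y = 0 := by
  have key : ∀ a b : Site 2, (a ∉ meshDomain Ω δ ∨ b ∉ meshDomain Ω δ) → ecur Ω δ h a b = 0 := by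
    intro a b hab
    apply ecur_of_not_adj
    intro hadj
    rcases hab with ha | hb
    · exact ha (discreteDomainGraph_adj_iff.1 hadj).2.1
    · exact hb (discreteDomainGraph_adj_iff.1 hadj).2.2
  -- the two positive directions
  have hright : ∀ x : Site 2, (sepLo x (x + Pi.single 0 1) ∉ meshDomain Ω δ ∨ sepHi x (x + Pi.single 0 1) ∉ meshDomain Ω δ) →
      stepFlux (ecurH Ω δ h) (ecurV Ω δ h) x (x + Pi.single 0 1) = 0 := by
    intro x hc
    rw [(sepLo_sepHi_right x).1, (sepLo_sepHi_right x).2] at hc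
    rw [stepFlux_right_ecur, key _ _ hc, neg_zero]
  have hup : ∀ x : Site 2, (sepLo x (x + Pi.single 1 1) ∉ meshDomain Ω δ ∨ sepHi x (x + Pi.single 1 1) ∉ meshDomain Ω δ) →
      stepFlux (ecurH Ω δ h) (ecurV Ω δ h) x (x + Pi.single 1 1) = 0 := by
    intro x hc
    rw [(sepLo_sepHi_up x).1, (sepLo_sepHi_up x).2] at hc
    rw [stepFlux_up_ecur, key _ _ hc]
  rcases stepKind_of_adj hxy with ⟨h0', h1'⟩ | ⟨h0', h1'⟩ | ⟨h1', h0'⟩ | ⟨h1', h0'⟩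
  · have hy : y = x + Pi.single 0 1 := by simp [Site.eq_iff_two, h0', h1']
    subst hy; exact hright x hc
  · have hx : x = y + Pi.single 0 1 := by simp [Site.eq_iff_two, h0', h1']
    subst hx
    rw [stepFlux_antisymm _ _ (.right (by simp) (by simp)), hright y (by rwa [sepLo_comm, sepHi_comm]), neg_zero]
  · have hy : y = x + Pi.single 1 1 := by simp [Site.eq_iff_two, h0', h1']
    subst hy; exact hup x hc
  · have hx : x = y + Pi.single 1 1 := by simp [Site.eq_iff_two, h0', h1']
    subst hx
    rw [stepFlux_antisymm _ _ (.up (by simp) (by simp)), hup y (by rwa [sepLo_comm, sepHi_comm]), neg_zero]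


/-! ### Inner faces in the bulk -/



/-- **Inner squares in the bulk.** If `B̄(z, r) ⊆ Ω`, then for all small meshes every square
whose lower-left mesh point lies in `B(z, r/2)` is inner. [folklore] -/
theorem exists_forall_isInnerFace (D : JordanDomain) {z : ℂ} {r : ℝ} (hr : 0 < r) (hzr : closedBall z r ⊆ D.carrier) :
    ∃ δ₀ > 0, ∀ δ, 0 < δ → δ < δ₀ → ∀ x : Site 2, meshPoint δ x ∈ ball z (r / 2) → IsInnerFace D.carrier δ x := by
  obtain ⟨δ₁, hδ₁, hdom⟩ := D.exists_forall_mem_meshDomain_and_reachable (isCompact_closedBall z r) hzr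
  refine ⟨min δ₁ (r / 8), by positivity, fun δ hδ hδlt x hx => ?_⟩
  have hδ₁' : δ < δ₁ := hδlt.trans_le (min_le_left _ _)
  have hδr : δ < r / 8 := hδlt.trans_le (min_le_right _ _)
  have hsq : closedSq δ x ⊆ closedBall z r := by
    intro w hw
    have h1 := dist_le_of_mem_closedSq hw (meshPoint_mem_closedSq hδ.le (Or.inl rfl) (Or.inl rfl) : meshPoint δ x ∈ closedSq δ x)
    rw [Metric.mem_closedBall]
    rw [Metric.mem_ball] at hx
    linarith [dist_triangle w (meshPoint δ x) z]
  have hsqΩ : closedSq δ x ⊆ D.carrier := hsq.trans hzr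
  refine isInnerFace_of_sides_subset ?_ ?_ ?_ ?_ (Or.inl ((hdom δ hδ hδ₁').1 x (hsq (meshPoint_mem_closedSq hδ.le (Or.inl rfl) (Or.inl rfl)))))
  · exact (side_subset_closedSq hδ.le ⟨Or.inl rfl, Or.inl rfl⟩ ⟨Or.inr (by simp), Or.inl (by simp)⟩).trans hsqΩ
  · exact (side_subset_closedSq hδ.le ⟨Or.inl (by simp), Or.inr (by simp)⟩ ⟨Or.inr (by simp), Or.inr (by simp)⟩).trans hsqΩ
  · exact (side_subset_closedSq hδ.le ⟨Or.inl rfl, Or.inl rfl⟩ ⟨Or.inl (by simp), Or.inr (by simp)⟩).trans hsqΩ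
  · exact (side_subset_closedSq hδ.le ⟨Or.inr (by simp), Or.inl (by simp)⟩ ⟨Or.inr (by simp), Or.inr (by simp)⟩).trans hsqΩ

/-- **Squares touching a compact set inside `Ω` are inner for small meshes**: if `K ⊆ Ω` is
compact, for all small `δ` every square touching `K` is inner. [folklore] -/
theorem exists_forall_isInnerFace_of_near (D : JordanDomain) {K : Set ℂ} (hK : IsCompact K) (hKΩ : K ⊆ D.carrier) :
    ∃ δ₀ > 0, ∀ δ, 0 < δ → δ < δ₀ → ∀ x : Site 2, (∃ w ∈ K, w ∈ closedSq δ x) → IsInnerFace D.carrier δ x := by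
  -- thicken `K` inside `Ω`
  obtain ⟨ρ, hρ, hthick⟩ := hK.exists_thickening_subset_open D.isOpen hKΩ
  set K' : Set ℂ := Metric.cthickening (ρ / 2) K with hK'
  have hK'c : IsCompact K' := hK.cthickening
  have hK'Ω : K' ⊆ D.carrier := (Metric.cthickening_subset_thickening' hρ (by linarith) K).trans hthick
  obtain ⟨δ₁, hδ₁, hdom⟩ := D.exists_forall_mem_meshDomain_and_reachable hK'c hK'Ω
  refine ⟨min δ₁ (ρ / 8), by positivity, fun δ hδ hδlt x hx => ?_⟩
  have hδ₁' : δ < δ₁ := hδlt.trans_le (min_le_left _ _)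
  have hδr : δ < ρ / 8 := hδlt.trans_le (min_le_right _ _)
  obtain ⟨w, hwK, hwx⟩ := hx
  have hsq : closedSq δ x ⊆ K' := by
    intro v hv
    have h1 := dist_le_of_mem_closedSq hv hwx
    rw [hK']
    exact Metric.mem_cthickening_of_dist_le v w (ρ / 2) K hwK (by linarith)
  have hsqΩ : closedSq δ x ⊆ D.carrier := hsq.trans hK'Ω
  refine isInnerFace_of_sides_subset ?_ ?_ ?_ ?_ (Or.inl ((hdom δ hδ hδ₁').1 x (hsq (meshPoint_mem_closedSq hδ.le (Or.inl rfl) (Or.inl rfl)))))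
  · exact (side_subset_closedSq hδ.le ⟨Or.inl rfl, Or.inl rfl⟩ ⟨Or.inr (by simp), Or.inl (by simp)⟩).trans hsqΩ
  · exact (side_subset_closedSq hδ.le ⟨Or.inl (by simp), Or.inr (by simp)⟩ ⟨Or.inr (by simp), Or.inr (by simp)⟩).trans hsqΩ
  · exact (side_subset_closedSq hδ.le ⟨Or.inl rfl, Or.inl rfl⟩ ⟨Or.inl (by simp), Or.inr (by simp)⟩).trans hsqΩ
  · exact (side_subset_closedSq hδ.le ⟨Or.inr (by simp), Or.inl (by simp)⟩ ⟨Or.inr (by simp), Or.inr (by simp)⟩).trans hsqΩ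

/-- **A walk of inner squares through the base lies in the component.** [folklore] -/
theorem reachable_of_mem_support_inner {p₀ x y : Site 2} (w : (zdGraph 2).Walk x y)
    (hw : ∀ z ∈ w.support, IsInnerFace Ω δ z) (hp₀ : p₀ ∈ w.support) {q : Site 2} (hq : q ∈ w.support) :
    (faceGraph Ω δ).Reachable p₀ q := by
  classical
  obtain ⟨W₁, -⟩ := exists_faceGraph_walk (w.takeUntil p₀ hp₀) fun z hz => hw z (Walk.support_takeUntil_subset_support w hp₀ hz)
  obtain ⟨W₂, -⟩ := exists_faceGraph_walk (w.takeUntil q hq) fun z hz => hw z (Walk.support_takeUntil_subset_support w hq hz)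
  exact ⟨W₁.reverse.append W₂⟩



open Classical in
/-- **The flux identity.** Let `Λ = (n_bot → p_bot) ++ v ++ (p_top → n_top) ++ β` be a closed
walk of squares, `v` a walk of inner squares starting in the component of the base `p₀`, `β`
carrying no flux, and suppose the winding number of `Λ`
is `kT` at every face below-left of a vertex of `T` and `kB` at those of `B` (`T`, `B` the
Dirichlet vertex sets, disjoint, off which `h` is harmonic). Then the difference of the exit
values is `(kT - kB)` times the total current out of `T`. [folklore] -/
theorem faceExitVal_sub_faceExitVal_eq (R : ConformalRectangle) (hδ : 0 < δ) {h : Site 2 → ℝ} {T B : Set (Site 2)}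
    (hT : T ⊆ meshBoundary R.carrier δ) (hB : B ⊆ meshBoundary R.carrier δ)
    (hTB : Disjoint T B)
    (hharm : ∀ x, x ∉ T → x ∉ B →
      ∑ y ∈ ((zdGraph 2).neighborFinset x).filter (fun y => (discreteDomainGraph R.carrier δ).Adj x y), (h y - h x) = 0)
    {p₀ : Site 2} (hp₀ : IsInnerFace R.carrier δ p₀)
    {nb pb pt nt : Site 2} (hb : (zdGraph 2).Adj nb pb) (ht : (zdGraph 2).Adj pt nt)
    (v : (zdGraph 2).Walk pb pt) (hv : ∀ z ∈ v.support, IsInnerFace R.carrier δ z) (hreach : (faceGraph R.carrier δ).Reachable p₀ pb)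
    (β : (zdGraph 2).Walk nt nb) (hβ : walkFlux (ecurH R.carrier δ h) (ecurV R.carrier δ h) β = 0)
    (ST SB : Finset (Site 2)) (hST : ∀ u, u ∈ ST ↔ u + 1 ∈ T) (hSB : ∀ u, u ∈ SB ↔ u + 1 ∈ B)
    {kT kB : ℤ} (hwT : ∀ u ∈ ST, walkWinding ((Walk.cons hb v).append (Walk.cons ht β)) u = kT)
    (hwB : ∀ u ∈ SB, walkWinding ((Walk.cons hb v).append (Walk.cons ht β)) u = kB) :
    faceExitVal R.carrier δ h p₀ pt nt - faceExitVal R.carrier δ h p₀ pb nb =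
      ((kT - kB : ℤ) : ℝ) * ∑ u ∈ ST, divAt (ecurH R.carrier δ h) (ecurV R.carrier δ h) u := by
  obtain ⟨r₀, hr₀⟩ := (isBounded_iff_subset_closedBall (0 : ℂ)).1 R.isBounded
  set Λ := (Walk.cons hb v).append (Walk.cons ht β) with hΛ
  -- the flux of `Λ`
  have hflux : walkFlux (ecurH R.carrier δ h) (ecurV R.carrier δ h) Λ =
      faceExitVal R.carrier δ h p₀ pt nt - faceExitVal R.carrier δ h p₀ pb nb := by
    rw [hΛ, walkFlux_append, walkFlux_cons, walkFlux_cons, walkFlux_eq_facePot_sub R hδ hT hB hharm hp₀ hreach v hv,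
      hβ, faceExitVal, faceExitVal, stepFlux_antisymm _ _ (stepKind_of_adj hb.symm)]
    ring
  -- the support of the currents
  set S : Finset (Site 2) := (sqBox_finite 0 (⌈r₀ / δ⌉ + 1)).toFinset with hS
  have hSmem : ∀ u, u ∉ S → u ∉ sqBox 0 (⌈r₀ / δ⌉ + 1) := fun u hu hu' => hu ((Set.Finite.mem_toFinset _).2 hu')
  have hS1 : ∀ u ∉ S, ecurH R.carrier δ h u = 0 ∧ ecurV R.carrier δ h u = 0 := fun u hu =>
    (ecur_eq_zero_of_not_mem_sqBox hr₀ hδ h (hSmem u hu)).1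
  have hS2 : ∀ u ∉ S, ecurH R.carrier δ h (u - Pi.single 0 1) = 0 ∧ ecurV R.carrier δ h (u - Pi.single 1 1) = 0 := fun u hu =>
    (ecur_eq_zero_of_not_mem_sqBox hr₀ hδ h (hSmem u hu)).2
  -- `ST, SB ⊆ S`
  have hbox : ∀ u : Site 2, u + 1 ∈ meshBoundary R.carrier δ → u ∈ S := by
    intro u hu
    have hd : u + 1 ∈ meshDomain R.carrier δ := hu.1
    have hb' := mem_sqBox_of_mem_meshDomain hr₀ hδ hd
    rw [hS, Set.Finite.mem_toFinset, mem_sqBox]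
    rw [mem_sqBox] at hb'
    simp only [Pi.zero_apply, sub_zero, Pi.add_apply, Pi.one_apply] at hb' ⊢
    constructor <;> [have := hb'.1; have := hb'.2] <;> rw [abs_le] at this ⊢ <;> omega
  have hTS : ST ⊆ S := fun u hu => hbox u (hT ((hST u).1 hu))
  have hBS : SB ⊆ S := fun u hu => hbox u (hB ((hSB u).1 hu))
  have hdisj : Disjoint ST SB := by
    rw [Finset.disjoint_left]
    intro u hu hu'
    exact Set.disjoint_left.1 hTB ((hST u).1 hu) ((hSB u).1 hu')
  have hdiv : ∀ u ∈ S, u ∉ ST → u ∉ SB → divAt (ecurH R.carrier δ h) (ecurV R.carrier δ h) u = 0 := fun u _ h1 h2 =>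
    divAt_ecur_eq_zero hharm (fun h' => h1 ((hST u).2 h')) (fun h' => h2 ((hSB u).2 h'))
  rw [← hflux]
  exact walkFlux_eq_mul_sum_div hS1 hS2 hTS hBS hdisj hdiv Λ hwT hwB


/-- **Exit decomposition.** A walk of squares from the component `F₀` of the base to a square
outside it splits at an exit `(p, n)`: `p ∈ F₀`, `n ∉ F₀` adjacent, the initial piece inside
`F₀`, and `n` a vertex of the walk. [folklore] -/
theorem exists_exit_decomp {p₀ c s : Site 2} (w : (zdGraph 2).Walk c s)
    (hc : (faceGraph Ω δ).Reachable p₀ c) (hs : ¬ (faceGraph Ω δ).Reachable p₀ s) :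
    ∃ (p n : Site 2) (h : (zdGraph 2).Adj p n) (w₁ : (zdGraph 2).Walk c p) (w₂ : (zdGraph 2).Walk n s),
      w = w₁.append (Walk.cons h w₂) ∧ (∀ z ∈ w₁.support, (faceGraph Ω δ).Reachable p₀ z) ∧
      ¬ (faceGraph Ω δ).Reachable p₀ n ∧ n ∈ w.support ∧ (∀ z ∈ w₁.support, z ∈ w.support) := by
  obtain ⟨p, n, h, w₁, w₂, hw, hF, hn⟩ := SquareTiling.Walk.exists_first_exit (F := {q | (faceGraph Ω δ).Reachable p₀ q}) w hc hs
  refine ⟨p, n, h, w₁, w₂, hw, hF, hn, ?_, ?_⟩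
  · rw [hw, Walk.support_append]; simp
  · intro z hz; rw [hw, Walk.support_append]; exact List.mem_append_left _ hz



/-- **Face walks along a boundary arc.** For a vertex `x` of the discrete arc `A_δ` (`A = arc i`) and a point
`e = boundary σₑ` of the same arc, there is a walk of faces from the face `x - 1` (the square with
upper-right corner `x`) to the square of `e`, all of whose faces touch points within `2δ` of the
arc. [folklore] -/
theorem exists_faceWalk_along_arc (R : ConformalRectangle) (hδ : 0 < δ) (i : Fin 4) {x : Site 2}
    (hx : x ∈ discreteArc R.carrier δ (R.arc i)) {σₑ : ℝ} (hσₑ : σₑ ∈ Icc (R.mark i) (R.nextMark i)) :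
    ∃ P : (zdGraph 2).Walk (x - 1) (floorSq δ (R.boundary σₑ)),
      ∀ f ∈ P.support, ∃ w ∈ closedSq δ f, Metric.infDist w (R.arc i) ≤ 2 * δ := by
  classical
  obtain ⟨t, htA, hxt⟩ := exists_dist_le_of_mem_discreteArc R.isOpen (R.isCompact_arc i) ⟨R.pt i, R.pt_mem_arc_self i⟩ hx
  rw [abs_of_pos hδ] at hxt
  obtain ⟨σₓ, hσₓ, rfl⟩ := htA
  -- the centre of the face `x - 1`
  set c : ℂ := meshPoint δ x - (δ / 2 : ℝ) * (1 + Complex.I) with hc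
  have hcsq : c ∈ closedSq δ (x - 1) := by
    refine ⟨?_, ?_, ?_, ?_⟩ <;> simp [hc, meshPoint] <;> nlinarith
  have hcx : dist c (meshPoint δ x) ≤ δ := by
    rw [hc, dist_eq_norm, show meshPoint δ x - (δ / 2 : ℝ) * (1 + Complex.I) - meshPoint δ x = -((δ / 2 : ℝ) * (1 + Complex.I)) by ring,
      norm_neg, norm_mul, Complex.norm_real, Real.norm_eq_abs, abs_of_pos (by positivity)]
    have : ‖(1 : ℂ) + Complex.I‖ ≤ 2 := by
      calc ‖(1 : ℂ) + Complex.I‖ ≤ ‖(1 : ℂ)‖ + ‖Complex.I‖ := norm_add_le _ _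
        _ = 2 := by simp; norm_num
    nlinarith
  -- first piece: the segment from `c` to the arc point
  set γ₁ : ℝ → ℂ := fun s => AffineMap.lineMap c (R.boundary σₓ) s with hγ₁
  have hγ₁c : ContinuousOn γ₁ (Icc 0 1) := AffineMap.lineMap_continuous.continuousOn
  have hγ₁0 : γ₁ 0 = c := by simp [hγ₁]
  have hγ₁1 : γ₁ 1 = R.boundary σₓ := by simp [hγ₁]
  obtain ⟨S₁, -, hS₁⟩ := exists_dualWalk_of_path hδ zero_le_one hγ₁c (P := x - 1) (P' := floorSq δ (R.boundary σₓ))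
    (by rw [hγ₁0]; exact hcsq) (by rw [hγ₁1]; exact mem_closedSq_floorSq hδ _)
  have hnear₁ : ∀ f ∈ S₁.support, ∃ w ∈ closedSq δ f, Metric.infDist w (R.arc i) ≤ 2 * δ := by
    intro f hf
    obtain ⟨s, hs, hγs⟩ := hS₁ f hf
    refine ⟨γ₁ s, hγs, ?_⟩
    have hmem : R.boundary σₓ ∈ R.arc i := ⟨σₓ, hσₓ, rfl⟩
    refine (Metric.infDist_le_dist_of_mem hmem).trans ?_
    have hseg : γ₁ s ∈ segment ℝ c (R.boundary σₓ) := by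
      rw [segment_eq_image_lineMap]; exact ⟨s, hs, rfl⟩
    have := (convex_closedBall (R.boundary σₓ) (2 * δ)).segment_subset ?_ (Metric.mem_closedBall_self (by positivity)) hseg
    · rwa [Metric.mem_closedBall] at this
    · rw [Metric.mem_closedBall]
      linarith [dist_triangle c (meshPoint δ x) (R.boundary σₓ)]
  -- second piece: along the arc
  have harc : ∀ {u v : ℝ}, u ≤ v → u ∈ Icc (R.mark i) (R.nextMark i) → v ∈ Icc (R.mark i) (R.nextMark i) →
      ∃ S : (zdGraph 2).Walk (floorSq δ (R.boundary u)) (floorSq δ (R.boundary v)),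
        ∀ f ∈ S.support, ∃ w ∈ closedSq δ f, Metric.infDist w (R.arc i) ≤ 2 * δ := by
    intro u v huv hu hv
    obtain ⟨S, -, hS⟩ := exists_dualWalk_of_path hδ huv (R.continuous_boundary.continuousOn)
      (P := floorSq δ (R.boundary u)) (P' := floorSq δ (R.boundary v)) (mem_closedSq_floorSq hδ _) (mem_closedSq_floorSq hδ _)
    refine ⟨S, fun f hf => ?_⟩
    obtain ⟨s, hs, hγs⟩ := hS f hf
    refine ⟨R.boundary s, hγs, ?_⟩
    have : R.boundary s ∈ R.arc i := ⟨s, ⟨hu.1.trans hs.1, hs.2.trans hv.2⟩, rfl⟩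
    rw [Metric.infDist_zero_of_mem this]; positivity
  rcases le_total σₓ σₑ with hle | hle
  · obtain ⟨S₂, hS₂⟩ := harc hle hσₓ hσₑ
    refine ⟨S₁.append S₂, fun f hf => ?_⟩
    rw [Walk.support_append] at hf
    rcases List.mem_append.1 hf with hf | hf
    · exact hnear₁ f hf
    · exact hS₂ f (List.tail_subset _ hf)
  · obtain ⟨S₂, hS₂⟩ := harc hle hσₑ hσₓ
    refine ⟨S₁.append S₂.reverse, fun f hf => ?_⟩
    rw [Walk.support_append] at hf
    rcases List.mem_append.1 hf with hf | hf
    · exact hnear₁ f hf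
    · exact hS₂ f (by have := List.tail_subset _ hf; rwa [Walk.support_reverse, List.mem_reverse] at this)


end KirchhoffSlope

end Summit.CriticalPhenomena.CardyFormulaZ2.Theorems
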